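import Mathlib
import Summits.NavierStokesRegularity.NavierStokesRegularity.Theorems.EulerZoomLiouvillePowerGaugeEulerLiouvilleSelfSimilarBoundedLoc
import Summits.NavierStokesRegularity.NavierStokesRegularity.Theorems.EulerZoomLiouvillePowerGaugeEulerLiouvilleSelfSimilarSublinearConfinement
import HarnessLib.Audit

/-!
# Rung C1 of the crux `EulerZoomLiouville.PowerGaugeEulerLiouville` (sub-stratum W3b): A `C²` SELF-SIMILAR EULER PROFILE OF
# SUBLINEAR GROWTH IS CONSTANT — the classical stratum widens from «V ∈ C² ∩ L^∞» to «V ∈ C², V(y) = o(|y|)»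

Route №10 `EulerZoomLiouville` (NavierStokesRegularity), crux E = stmt-NavierStokesRegularity-19832, tenure rung C1,
registered residue `stub_selfSimilarExtremalRest`, sub-stratum W3b («`C²` profiles UNBOUNDED at infinity», recorded as
«no lever» in the lead's census v16).  Lineage ns-typeII-p1 (gen 8).

The lever.  In the cutoff localisation of `Loc.curl_eq_zero_of_bounded` (ns-typeII-p2 g8, `…SelfSimilarBoundedLoc`) the
bound `‖U‖ ≤ M` is used at exactly one place: to confine every BACKWARD similarity orbit `s ↦ Φ_s x`, `s ≤ 0`, of
`W = γy + Ṽ` to the ball `‖y‖ ≤ ‖x‖ + M/γ` (`C2.Kelvin.norm_flow_le_of_nonpos'`), so that the flow of the cut-off field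
`Ṽ = χU` never sees the cutoff.  Confinement needs much less: if `‖U(y)‖ ≤ (γ/2)‖y‖` for `‖y‖ ≥ R`, then along any orbit
`d/ds ½‖Y‖² = γ‖Y‖² + ⟪Y, U(Y)⟫ ≥ (γ/2)‖Y‖² > 0` as long as `‖Y‖ ≥ R`, so the sphere `‖y‖ = max(‖x‖, R)` is a BARRIER
that no backward orbit from `x` crosses (`norm_flow_le_max_of_nonpos`, a fencing argument,
`image_le_of_deriv_right_lt_deriv_boundary'`).  Everything else in the three-lineage argument is local (it runs inside the
confinement ball, where `Ṽ = U`) or profile-free, and the Liouville endgame for an irrotational incompressible field is the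
tree's sublinear-growth Liouville theorem `HarmonicOnNhd.apply_eq_apply_of_sublinear`, whose hypothesis is literally
`U(y) = o(|y|)`.  Hence:

(Tools in the companion `…SelfSimilarSublinearConfinement`: `exists_cutoff_local` — the cutoff `Ṽ = χU` without a bound on
`U`; `norm_flow_le_max_of_nonpos` — the barrier confinement; `eq_const_of_curl_eq_zero_of_sublinear` — the Liouville step.)

* **`curl_eq_zero_of_sublinear`**, **`eq_const_of_sublinear`** — `(U, P)` a self-similar Euler profile (CIV (3.3); so
  `U ∈ C²`) with `0 < γ < ½` and SUBLINEAR GROWTH `∀ δ > 0, ∃ R, ∀ y, R ≤ ‖y‖ → ‖U y‖ ≤ δ‖y‖` ⇒ `curl U ≡ 0` and `U` is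
  CONSTANT;
* **`selfSimilar_ae_eq_zero_of_sublinearC2_profile`** — MEMBER LEVEL, crux hypotheses verbatim (`0 < ρ < 1`) + exact
  self-similarity: if the velocity profile is `C²` and of sublinear growth, the member vanishes (the `A`-gauge kills the
  constant).  This strictly contains the v16 stratum «`V ∈ C² ∩ L^∞`» (`Loc.selfSimilar_ae_eq_zero_of_boundedC2_profile`).

Sharpness of the PROFILE-LEVEL statement: growth `O(|y|)` is not enough — the linear strain `U = Ay` (`A` symmetric,
`tr A = 0`, `P = −½ yᵀ(A + A²)y`) is a non-constant `C^∞` solution of (3.3) for every `γ` (companion file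
`…SelfSimilarLinearStrainProfile`); such profiles are excluded only at member level, by the gauge.  So after this file the
`C²` residue of `stub_selfSimilarExtremalRest` is: profiles with `limsup_{|y|→∞} ‖U(y)‖/‖y‖ > 0` (linear or faster growth
along a sparse set — the `A`-gauge forces `∫_{B_L}‖U‖² ≲ L^{1−2ρ}`), and the weak class.

WHAT THIS IS NOT: not NS, not E, not rung C1 — the weak class (`V ∉ C²`), `C²` profiles of linear-or-faster growth at
infinity, and all non-self-similar members remain. [folklore; ChaeShvydkoy2013 §4 Thm 4.1 (setting: the irrotational
Liouville endgame); ConstantinIgnatovaVicol2026Putative §3 (setting); GilbargTrudinger2001 Thm 2.1]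
-/

noncomputable section

-- flat `Theorems/<Route><Decl>…` files of one crux share the namespace of the crux (tree convention)
set_option linter.dupNamespace false

open MeasureTheory Set Filter Topology Metric Function InnerProductSpace
open scoped RealInnerProductSpace NNReal ENNReal ContDiff Laplacian

namespace Summit.NavierStokesRegularity.NavierStokesRegularity.Theorems.PowerGaugeEulerLiouville.Loc

open Literature.Analysis Literature.Analysis.FluidPDE
open Summit.NavierStokesRegularity.NavierStokesRegularity.Theorems.PowerGaugeEulerLiouville.Kelvin

variable {γ : ℝ} {U : EuclideanSpace ℝ (Fin 3) → EuclideanSpace ℝ (Fin 3)} {P : EuclideanSpace ℝ (Fin 3) → ℝ}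

/-! ### A `C²` profile of sublinear growth is irrotational, hence constant -/

/-- **A `C²` SELF-SIMILAR EULER PROFILE OF SUBLINEAR GROWTH IS IRROTATIONAL** (`0 < γ < ½`): `(U, P)` satisfies CIV (3.3)
(so `U ∈ C²`) and `U(y) = o(|y|)` (`∀ δ > 0, ∃ R, ‖U y‖ ≤ δ‖y‖` for `‖y‖ ≥ R`) ⇒ `curl U x₀ = 0` for every `x₀`.  Cutoff
localisation around the BARRIER ball of `ball x₀ 1` (module docstring); the proof is `Loc.curl_eq_zero_of_bounded` with the
confinement `‖Φ_s x‖ ≤ ‖x‖ + M/γ` replaced by `norm_flow_le_max_of_nonpos`. [folklore; three-lineage chain of the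
ns-regularity-ideate cell, localised] -/
theorem curl_eq_zero_of_sublinear (hprof : IsSelfSimilarEulerProfile γ 0 U P)
    (hsub : ∀ δ : ℝ, 0 < δ → ∃ R : ℝ, ∀ y : EuclideanSpace ℝ (Fin 3), R ≤ ‖y‖ → ‖U y‖ ≤ δ * ‖y‖)
    (hγ : 0 < γ) (hγ2 : γ < 1 / 2) (x₀ : EuclideanSpace ℝ (Fin 3)) : curl U x₀ = 0 := by
  have hU2 : ContDiff ℝ 2 U := hprof.contDiff_velocity
  have hU1 : ContDiff ℝ 1 U := hU2.of_le (by norm_num)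
  -- the barrier radius `R ≥ 1`: `‖U y‖ ≤ (γ/2)‖y‖` for `‖y‖ ≥ R`
  obtain ⟨R₁, hR₁⟩ := hsub (γ / 2) (by positivity)
  set R : ℝ := max R₁ 1 with hRdef
  have hR : 0 < R := lt_of_lt_of_le one_pos (le_max_right _ _)
  have hfarU : ∀ y : EuclideanSpace ℝ (Fin 3), R ≤ ‖y‖ → ‖U y‖ ≤ γ / 2 * ‖y‖ :=
    fun y hy => hR₁ y ((le_max_left _ _).trans hy)
  -- a global linear-growth bound for `U` (continuity on the barrier ball)
  obtain ⟨B, hB⟩ := (isCompact_closedBall (0 : EuclideanSpace ℝ (Fin 3)) R).exists_bound_of_continuousOn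
    hU2.continuous.continuousOn
  have hB0 : 0 ≤ max B 0 := le_max_right _ _
  have hUlin : ∀ y : EuclideanSpace ℝ (Fin 3), ‖U y‖ ≤ γ / 2 * ‖y‖ + max B 0 := by
    intro y
    by_cases hy : ‖y‖ ≤ R
    · have h1 : ‖U y‖ ≤ B := hB y (by rwa [mem_closedBall, dist_zero_right])
      have h2 : 0 ≤ γ / 2 * ‖y‖ := by positivity
      linarith [le_max_left B 0]
    · push Not at hy
      linarith [hfarU y hy.le]
  set R₀ : ℝ := max (‖x₀‖ + 1) R with hR₀def
  have hR₀ : 0 < R₀ := lt_of_lt_of_le hR (le_max_right _ _)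
  have hRR₀ : R ≤ R₀ := le_max_right _ _
  -- the cutoff field
  obtain ⟨V, hV, ⟨M, hVM⟩, hVle, ⟨K, hK⟩, hagree⟩ := exists_cutoff_local hU2 (R := R₀ + 1) (by linarith)
  have hV1 : ContDiff ℝ 1 V := hV.of_le (by norm_num)
  have hfarV : ∀ y : EuclideanSpace ℝ (Fin 3), R ≤ ‖y‖ → ‖V y‖ ≤ γ / 2 * ‖y‖ :=
    fun y hy => (hVle y).trans (hfarU y hy)
  have hnear : ∀ z : EuclideanSpace ℝ (Fin 3), ‖z‖ ≤ R₀ → V =ᶠ[𝓝 z] U := by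
    intro z hz
    have hmem : ball (0 : EuclideanSpace ℝ (Fin 3)) (R₀ + 1) ∈ 𝓝 z :=
      isOpen_ball.mem_nhds (by rw [mem_ball, dist_zero_right]; linarith)
    exact Filter.eventually_of_mem hmem fun y hy => hagree y hy
  have hDeq : ∀ z : EuclideanSpace ℝ (Fin 3), ‖z‖ ≤ R₀ → fderiv ℝ V z = fderiv ℝ U z :=
    fun z hz => (hnear z hz).fderiv_eq
  have hcurlEq : ∀ z : EuclideanSpace ℝ (Fin 3), ‖z‖ ≤ R₀ → curl V z = curl U z :=
    fun z hz => curl_congr_fderiv (hDeq z hz)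
  have hWeq : ∀ z : EuclideanSpace ℝ (Fin 3), ‖z‖ < R₀ + 1 →
      selfSimilarTransport γ 0 V z = selfSimilarTransport γ 0 U z := by
    intro z hz
    simp only [selfSimilarTransport_apply, hagree z (by rwa [mem_ball, dist_zero_right])]
  set Φ := ODE.evolutionMap (fun _ : ℝ => selfSimilarTransport γ 0 V) 0 with hΦ
  -- the bad set of `V` inside the closed ball `R₀`
  set Bd : Set (EuclideanSpace ℝ (Fin 3)) := {z | z ∈ selfSimilarNodalSet γ 0 V ∧ ‖z‖ ≤ R₀ ∧
    ∃ w : EuclideanSpace ℝ (Fin 3), ‖w‖ = 1 ∧ 1 ≤ ⟪fderiv ℝ V z w, w⟫} with hBd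
  have hBc : IsCompact Bd := by
    have hWc : Continuous (selfSimilarTransport γ 0 V) := (contDiff_selfSimilarTransport (γ := γ) hV).continuous
    have h1 : IsClosed (selfSimilarNodalSet γ 0 V) := isClosed_eq hWc continuous_const
    have h2 : IsClosed {z : EuclideanSpace ℝ (Fin 3) | ‖z‖ ≤ R₀} := isClosed_le continuous_norm continuous_const
    have h3 := isClosed_badSet_of_contDiff hV1
    have hcl : IsClosed Bd := by
      rw [hBd, setOf_and, setOf_and]
      exact h1.inter (h2.inter h3)
    refine (isCompact_closedBall (0 : EuclideanSpace ℝ (Fin 3)) R₀).of_isClosed_subset hcl fun z hz => ?_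
    rw [mem_closedBall, dist_zero_right]; exact hz.2.1
  -- every point of `Bd` is thin for the `V`-flow
  have hthin : ∀ z ∈ Bd, ∃ T : ℝ, 0 < T ∧ ∃ r : ℝ, 0 < r ∧ volume {q : EuclideanSpace ℝ (Fin 3) |
      ∃ qs : ℕ → EuclideanSpace ℝ (Fin 3), qs 0 = q ∧ (∀ k, Φ T (qs (k + 1)) = qs k) ∧ ∀ k, qs k ∈ ball z r} = 0 := by
    rintro z ⟨hzN, hzR, hbad⟩
    by_cases hc : curl V z = 0
    · -- non-vortical: block data from the true profile `U`, transported by `DV z = DU z`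
      have hcU : curl U z = 0 := by rwa [hcurlEq z hzR] at hc
      have hbadU : ∃ w : EuclideanSpace ℝ (Fin 3), ‖w‖ = 1 ∧ 1 ≤ ⟪fderiv ℝ U z w, w⟫ := by
        rw [← hDeq z hzR]; exact hbad
      obtain ⟨b, lam, β, hA0, hA1, hA2, hshape⟩ :=
        exists_thinBlock_of_curl_eq_zero_of_bad (hU1.differentiable one_ne_zero) hprof.divFree hγ2 hcU hbadU
      rw [← hDeq z hzR] at hA0 hA1 hA2
      rcases hshape with ⟨h2, h20, h21⟩ | ⟨h0, h1, h02, h12⟩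
      · exact C2.Kelvin.exists_trappedSet_null_of_dominatedBlock hV hK hzN b lam β hA0 hA1 hA2 h2 h20 h21
      · exact C2.Kelvin.exists_trappedSet_null_of_contractingPlane hV hK hzN b lam β hA0 hA1 hA2 h0 h1 h02 h12
    · -- vortical: pointwise profile facts from `U`
      have hzNU : z ∈ selfSimilarNodalSet γ 0 U := by
        rw [mem_selfSimilarNodalSet_iff] at hzN ⊢
        have := hWeq z (by linarith)
        simp only [selfSimilarTransport_apply] at this
        rwa [this] at hzN
      have heig : fderiv ℝ V z (curl V z) = curl V z := by
        rw [hDeq z hzR, hcurlEq z hzR]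
        exact hprof.isSelfSimilarEulerVorticityProfile.fderiv_apply_curl_eq_of_mem_nodalSet hzNU
      have hdivz : LinearMap.trace ℝ _ ((fderiv ℝ V z : EuclideanSpace ℝ (Fin 3) →L[ℝ] EuclideanSpace ℝ (Fin 3)) :
          EuclideanSpace ℝ (Fin 3) →ₗ[ℝ] EuclideanSpace ℝ (Fin 3)) = 0 := by
        rw [hDeq z hzR]; exact hprof.divFree z
      exact exists_trappedSet_null_of_curl_ne_zero_loc hV hK (by linarith) hγ2 hzN hc heig hdivz
  have hnull := C2.Kelvin.volume_setOf_tendsto_flow_atBot_mem_eq_zero_of_trappedSets hV hK hBc hthin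
  -- every vortical point near `x₀` flows backward into `Bd`
  have hsubset : {x : EuclideanSpace ℝ (Fin 3) | dist x x₀ < 1 ∧ curl U x ≠ 0} ⊆
      {x : EuclideanSpace ℝ (Fin 3) | ∃ z ∈ Bd, Tendsto (fun s => Φ s x) atBot (𝓝 z)} := by
    rintro x ⟨hx, hcx⟩
    have hxn : ‖x‖ ≤ ‖x₀‖ + 1 := by
      have := norm_le_norm_add_norm_sub' x x₀
      rw [← dist_eq_norm] at this
      linarith
    have hxR : max ‖x‖ R ≤ R₀ := max_le (hxn.trans (le_max_left _ _)) hRR₀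
    -- the backward half-orbit and its BARRIER confinement
    set Yp : ℝ → EuclideanSpace ℝ (Fin 3) := fun t => Φ (-t) x with hYp
    have hYpV : ∀ t, HasDerivAt Yp ((-1 : ℝ) • selfSimilarTransport γ 0 V (Yp t)) t :=
      fun t => C2.Kelvin.hasDerivAt_flow_neg (γ := γ) hV1 hK x t
    have hconf : ∀ t, 0 ≤ t → ‖Yp t‖ ≤ R₀ :=
      fun t ht => (norm_flow_le_max_of_nonpos hV1 hK hγ hR hfarV x (s := -t) (by linarith)).trans hxR
    have hYpU : ∀ t, 0 ≤ t → HasDerivAt Yp ((-1 : ℝ) • selfSimilarTransport γ 0 U (Yp t)) t := by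
      intro t ht
      have h := hYpV t
      rwa [hWeq (Yp t) (by linarith [hconf t ht])] at h
    -- a global `W_U`-curve extending it
    have hWU1 : ContDiff ℝ 1 (selfSimilarTransport γ 0 U) := contDiff_selfSimilarTransport (γ := γ) hU1
    have hgrowth : ∀ y, ‖selfSimilarTransport γ 0 U y‖ ≤ (γ + γ / 2) * ‖y‖ + max B 0 := by
      intro y
      rw [selfSimilarTransport_apply, sub_zero]
      calc ‖γ • y + U y‖ ≤ ‖γ • y‖ + ‖U y‖ := norm_add_le _ _
        _ ≤ γ * ‖y‖ + (γ / 2 * ‖y‖ + max B 0) := by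
            rw [norm_smul, Real.norm_of_nonneg hγ.le]; exact add_le_add le_rfl (hUlin y)
        _ = (γ + γ / 2) * ‖y‖ + max B 0 := by ring
    obtain ⟨Y, hYeq, hY⟩ := exists_hasDerivAt_extension_of_linearGrowth hWU1 (by positivity) hB0 hgrowth hYpU
    have hBdY : ∀ t, 0 ≤ t → ‖Y t‖ ≤ R₀ := fun t ht => by rw [hYeq t ht]; exact hconf t ht
    have hY0 : Y 0 = x := by
      rw [hYeq 0 le_rfl, hYp]
      simp only [neg_zero, hΦ, ODE.evolutionMap_self]
    have hx0 : curl U (Y 0) ≠ 0 := by rw [hY0]; exact hcx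
    -- ns-typeII-p1's limit-set kill on the `U`-curve
    obtain ⟨z', hz'N, hz'R, hcl', w, hw, hbadw⟩ :=
      NodalContinuum.exists_mapClusterPt_stretching_ge_one hprof (ne_of_lt hγ2) hY hBdY hx0
    -- transfer to the `V`-orbit
    have hEq : Y =ᶠ[atTop] Yp := (eventually_ge_atTop (0 : ℝ)).mono fun t ht => hYeq t ht
    have hclYp : MapClusterPt z' atTop Yp := by
      have hmap : map Y atTop = map Yp atTop := Filter.map_congr hEq
      unfold MapClusterPt at hcl' ⊢
      rwa [hmap] at hcl'
    have hcl : MapClusterPt z' atBot (fun s => Φ s x) := by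
      have e : Yp = (fun s => Φ s x) ∘ Neg.neg := rfl
      rw [e, mapClusterPt_comp, Filter.map_neg_atTop] at hclYp
      exact hclYp
    -- point hypotheses from the profile along the `U`-curve
    have hWeqt : ∀ t, 0 ≤ t → selfSimilarTransport γ 0 U (Y t) = selfSimilarTransport γ 0 V (Yp t) := by
      intro t ht
      rw [hYeq t ht, hWeq (Yp t) (by linarith [hconf t ht])]
    have htendsU := hprof.tendsto_transport_comp_of_bounded (ne_of_lt hγ2) (σ := -1) (by norm_num) hY hBdY
    have htendsYp : Tendsto (fun t => selfSimilarTransport γ 0 V (Yp t)) atTop (𝓝 0) :=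
      htendsU.congr' ((eventually_ge_atTop (0 : ℝ)).mono fun t ht => hWeqt t ht)
    have htends : Tendsto (fun s => selfSimilarTransport γ 0 V (Φ s x)) atBot (𝓝 0) := by
      have h := htendsYp.comp tendsto_neg_atBot_atTop
      refine h.congr fun s => ?_
      simp only [Function.comp_apply, hYp, neg_neg]
    obtain ⟨C, hC⟩ := hprof.exists_integral_norm_transport_sq_le (ne_of_lt hγ2) (σ := -1) (by norm_num) hY hBdY
    have hcont : Continuous fun t : ℝ => ‖selfSimilarTransport γ 0 V (Φ (-t) x)‖ ^ 2 :=
      ((((contDiff_selfSimilarTransport (γ := γ) hV).continuous.comp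
        ((C2.Kelvin.continuous_flow_apply (γ := γ) hV1 hK x).comp continuous_neg)).norm).pow 2)
    have hint : IntegrableOn (fun t : ℝ => ‖selfSimilarTransport γ 0 V (Φ (-t) x)‖ ^ 2) (Ioi 0) := by
      refine integrableOn_Ioi_of_intervalIntegral_norm_bounded C 0 (l := atTop) (b := fun n : ℕ => (n : ℝ))
        (fun n => (hcont.integrableOn_Icc).mono_set Ioc_subset_Icc_self) tendsto_natCast_atTop_atTop ?_
      refine Eventually.of_forall fun n => ?_
      have h := hC 0 n le_rfl (Nat.cast_nonneg n)
      refine le_trans (le_of_eq ?_) h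
      refine intervalIntegral.integral_congr fun t ht => ?_
      rw [uIcc_of_le (Nat.cast_nonneg n)] at ht
      simp only [Real.norm_eq_abs, abs_pow, abs_norm]
      rw [hWeqt t ht.1]
    -- node facts at `z'`
    have hDz : fderiv ℝ V z' = fderiv ℝ U z' := hDeq z' hz'R
    have hz'NV : z' ∈ selfSimilarNodalSet γ 0 V := by
      rw [mem_selfSimilarNodalSet_iff] at hz'N ⊢
      have := hWeq z' (by linarith)
      simp only [selfSimilarTransport_apply] at this
      rwa [← this] at hz'N
    have hdiv0 : LinearMap.trace ℝ _ ((fderiv ℝ V z' : EuclideanSpace ℝ (Fin 3) →L[ℝ] EuclideanSpace ℝ (Fin 3)) :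
        EuclideanSpace ℝ (Fin 3) →ₗ[ℝ] EuclideanSpace ℝ (Fin 3)) = 0 := by
      rw [hDz]; exact hprof.divFree z'
    have heig : curl V z' ≠ 0 → fderiv ℝ V z' (curl V z') = curl V z' := fun _ => by
      rw [hDz, hcurlEq z' hz'R]
      exact hprof.isSelfSimilarEulerVorticityProfile.fderiv_apply_curl_eq_of_mem_nodalSet hz'N
    have hbadV : 1 ≤ ⟪fderiv ℝ V z' w, w⟫ := by rw [hDz]; exact hbadw
    obtain ⟨z, hzN, hz⟩ := tendsto_flow_atBot_of_badClusterPt_loc hV hK hVM hγ hγ2 x htends hint hcl hdiv0 heig hw hbadV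
    have hzz' : z' = z := eq_of_nhds_neBot (hcl.clusterPt.mono hz)
    exact ⟨z, ⟨hzN, hzz' ▸ hz'R, w, hw, hzz' ▸ hbadV⟩, hz⟩
  -- an open null set is empty
  have hopen : IsOpen {x : EuclideanSpace ℝ (Fin 3) | dist x x₀ < 1 ∧ curl U x ≠ 0} := by
    have h1 : IsOpen {x : EuclideanSpace ℝ (Fin 3) | dist x x₀ < 1} := isOpen_lt (continuous_id.dist continuous_const) continuous_const
    exact h1.inter (isOpen_ne_fun (differentiable_curl_of_contDiff hU2).continuous continuous_const)
  have hzero : volume {x : EuclideanSpace ℝ (Fin 3) | dist x x₀ < 1 ∧ curl U x ≠ 0} = 0 := measure_mono_null hsubset hnull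
  have hempty := (hopen.measure_eq_zero_iff volume).1 hzero
  by_contra hx₀
  have : x₀ ∈ ({x : EuclideanSpace ℝ (Fin 3) | dist x x₀ < 1 ∧ curl U x ≠ 0} : Set _) := ⟨by simp, hx₀⟩
  rw [hempty] at this
  exact this

/-- **RIGIDITY UNDER SUBLINEAR GROWTH: a `C²` self-similar Euler profile with `U(y) = o(|y|)` is CONSTANT** (`0 < γ < ½`;
no hypothesis on the pressure, the gradient, the far field or the stagnation set; strictly contains
`Loc.eq_const_of_bounded`).  Sharp at profile level: the linear strain `U = Ay` (`A` symmetric traceless) solves (3.3)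
for every `γ`. [folklore] -/
theorem eq_const_of_sublinear (hprof : IsSelfSimilarEulerProfile γ 0 U P)
    (hsub : ∀ δ : ℝ, 0 < δ → ∃ R : ℝ, ∀ y : EuclideanSpace ℝ (Fin 3), R ≤ ‖y‖ → ‖U y‖ ≤ δ * ‖y‖)
    (hγ : 0 < γ) (hγ2 : γ < 1 / 2) (x y : EuclideanSpace ℝ (Fin 3)) : U x = U y :=
  eq_const_of_curl_eq_zero_of_sublinear hprof.contDiff_velocity (curl_eq_zero_of_sublinear hprof hsub hγ hγ2)
    hprof.divFree hsub x y

/-! ### Member level: the classical stratum «V ∈ C², V(y) = o(|y|)» -/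

/-- **THE CLASSICAL STRATUM OF `stub_selfSimilarExtremalRest` UNDER SUBLINEAR GROWTH, MEMBER LEVEL.**  Crux hypotheses
verbatim (`0 < ρ < 1`) + exact self-similarity with profile `(V, P)`: if `V ∈ C²` and `V(y) = o(|y|)`
(`∀ δ > 0, ∃ R, ∀ y, R ≤ ‖y‖ → ‖V y‖ ≤ δ‖y‖` — in particular if `V` is bounded), then `u = 0` a.e. on `(−∞,0) × ℝ³`.
Nothing on the pressure (CIV (3.3) for some `C¹` pressure is derived), nothing on `DV`, the far field or the stagnation set;
rigidity makes `V` constant and the `A`-gauge kills the constant. [folklore] -/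
theorem selfSimilar_ae_eq_zero_of_sublinearC2_profile {ρ : ℝ} (hρ : 0 < ρ) (hρ1 : ρ < 1)
    {u : ℝ → EuclideanSpace ℝ (Fin 3) → EuclideanSpace ℝ (Fin 3)} {p : ℝ → EuclideanSpace ℝ (Fin 3) → ℝ}
    {H : ℝ → EuclideanSpace ℝ (Fin 3) → EuclideanSpace ℝ (Fin 3) →L[ℝ] EuclideanSpace ℝ (Fin 3)} {c : ℝ≥0}
    (hsw : IsSuitableWeakSolutionOn (slab (EuclideanSpace ℝ (Fin 3)) (Iio 0) isOpen_Iio) 0 0 u p)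
    (hgauge : ∀ a : ℝ, 0 < a →
      ENNReal.ofReal (a ^ (2 * ρ)) * cknA a (0 : ℝ × EuclideanSpace ℝ (Fin 3)) u +
          ENNReal.ofReal (a ^ ρ) * cknE a (0 : ℝ × EuclideanSpace ℝ (Fin 3)) H +
        ENNReal.ofReal (a ^ (2 * ρ)) * cknD a (0 : ℝ × EuclideanSpace ℝ (Fin 3)) p ≤ (c : ℝ≥0∞))
    {V : EuclideanSpace ℝ (Fin 3) → EuclideanSpace ℝ (Fin 3)} {P : EuclideanSpace ℝ (Fin 3) → ℝ}
    (hu : ∀ τ : ℝ, τ < 0 → u τ = selfSimilarCollapse (1 / (2 + ρ)) 0 V τ)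
    (hp : ∀ τ : ℝ, τ < 0 → p τ = selfSimilarCollapsePressure (1 / (2 + ρ)) 0 P τ)
    (hV : ContDiff ℝ 2 V)
    (hsub : ∀ δ : ℝ, 0 < δ → ∃ R : ℝ, ∀ y : EuclideanSpace ℝ (Fin 3), R ≤ ‖y‖ → ‖V y‖ ≤ δ * ‖y‖) :
    uncurry u =ᵐ[volume.restrict (Iio (0 : ℝ) ×ˢ (univ : Set (EuclideanSpace ℝ (Fin 3))))] 0 := by
  have h2ρ : (0 : ℝ) < 2 + ρ := by linarith
  have hγ : (0 : ℝ) < 1 / (2 + ρ) := one_div_pos.2 h2ρ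
  have hγ2 : 1 / (2 + ρ) < 1 / 2 := one_div_lt_one_div_of_lt two_pos (by linarith)
  have hA : ∀ a : ℝ, 0 < a → ENNReal.ofReal (a ^ (2 * ρ)) *
      cknA a (0 : ℝ × EuclideanSpace ℝ (Fin 3)) u ≤ (c : ℝ≥0∞) :=
    fun a ha => le_trans (le_trans le_self_add le_self_add) (hgauge a ha)
  have hD : ∀ a : ℝ, 0 < a → ENNReal.ofReal (a ^ (2 * ρ)) *
      cknD a (0 : ℝ × EuclideanSpace ℝ (Fin 3)) p ≤ (c : ℝ≥0∞) :=
    fun a ha => le_trans le_add_self (hgauge a ha)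
  have hpm : AEStronglyMeasurable (uncurry p)
      (volume.restrict (Iio (0 : ℝ) ×ˢ (univ : Set (EuclideanSpace ℝ (Fin 3))))) := by
    have := hsw.distributional.2.2.1.aestronglyMeasurable
    simpa [slab] using this
  have hPm := aestronglyMeasurable_pressureProfile hpm hp
  have hDprof := profile_pressure_weight_of_gaugeD hρ hρ1 hpm hp hD
  have hP1 : LocallyIntegrable P volume :=
    EnergySaturation.locallyIntegrable_pressure_of_weight hρ1 hPm
      (ENNReal.mul_ne_top ENNReal.ofReal_ne_top ENNReal.coe_ne_top) hDprof
  obtain ⟨P', hprof⟩ := WeakToClassical.exists_isSelfSimilarEulerProfile_of_contDiff hsw.distributional hu hp hV hP1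
  -- rigidity and the `A`-gauge
  have hconst := eq_const_of_sublinear hprof hsub hγ hγ2
  set a : EuclideanSpace ℝ (Fin 3) := V 0 with ha
  have hVa : V = fun _ => a := funext fun z => hconst z 0
  have hgrowth := profile_energy_growth_of_gaugeA hρ hu hA
  have ha0 : a = 0 := by
    refine NoDrift.eq_zero_of_const_of_lintegral_ball_le (C := (c : ℝ≥0∞)) ENNReal.coe_ne_top (θ := 1 - 2 * ρ)
      (by linarith) fun L hL => ?_
    have h := hgrowth L hL
    rw [hVa] at h
    exact h
  have hV0 : V = 0 := by rw [hVa, ha0]; rfl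
  exact selfSimilar_ae_eq_zero_of_profile_eq_zero u hu hV0

end Summit.NavierStokesRegularity.NavierStokesRegularity.Theorems.PowerGaugeEulerLiouville.Loc

end
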